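import Mathlib
import Literature.Analysis.Calculus.PoincareLemmaOneForm
import Literature.Analysis.FluidPDE.StretchedLayerNS
import HarnessLib

/-!
# Tools for the stub `stub_pressureReconstruction` (crux stmt-AnomalousDissipation-3009): slice calculus
# of curried plane fields and plane potentials of curl-free fields

Helper file for the line `braid-closed-large-circulation-gluing` of
`MarginalStabilityChain.StretchedVortexRows`. The stub reconstructs the pressure of a steady
stretched-layer Navier–Stokes velocity field given in vorticity form; this file supplies the
field-independent calculus:

* the slice derivatives `StretchedLayer.dX/dY` of a jointly `Cⁿ` curried field `f x y` are the
  Fréchet partial derivatives (`dX_eq_fderiv`, `dY_eq_fderiv`), are jointly `Cⁿ⁻¹`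
  (`contDiff_dX`, `contDiff_dY`, `contDiff_dX_of_le`, `contDiff_dY_of_le`), the slices have them
  as honest derivatives (`hasDerivAt_dX`, `hasDerivAt_dY`), `∂(f - g) = ∂f - ∂g` (`dX_fun_sub`,
  `dY_fun_sub`), and mixed partials of `C²` fields commute (`dX_dY_comm`);
* `∂ₓ`, `∂_y` of an `x`-periodic field are `x`-periodic (`dX_periodic`, `dY_periodic`);
* **plane Poincaré lemma in slice form** (`exists_potential`): a jointly `C¹` pair `(F₁, F₂)` with
  `∂_y F₁ = ∂ₓ F₂` is a gradient `(∂ₓ P, ∂_y P)` of a jointly `C¹` potential `P` (the radial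
  homotopy potential of `Literature.Analysis.Calculus.hasFDerivAt_radialIntegral`);
* `potential_shift_eq_integral`: if moreover `F₁, F₂` are `L`-periodic in `x`, then
  `P (x + L) y - P x y = ∫₀ᴸ F₁ (s, y₀) ds` for all `x, y, y₀` (so `P` is periodic iff one period
  integral of `F₁` vanishes);
* small analytic facts for the periodicity argument: period integrals of the exact terms
  `-(u uₓ) + ν uₓₓ` vanish (`integral_exact_terms_eq_zero`), a field with `|∂_y f| ≤ C` grows at
  most linearly across the layer (`abs_sub_le_of_dY_bound`), and `(A + B y) e^{-a y} → 0`
  (`tendsto_affine_mul_exp_neg`);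
* `stub_pressureReconstruction_planePotential` — the registered form of `exists_potential`.
-/

noncomputable section

set_option linter.dupNamespace false

open scoped Topology ContDiff
open Filter Set Function MeasureTheory intervalIntegral

namespace Summit.AnomalousDissipation.AnomalousDissipation.Theorems.MarginalStabilityChainStretchedVortexRows

namespace PressureTools

open Literature.Analysis.FluidPDE Literature.Analysis.FluidPDE.StretchedLayer

/-! ### Slice derivatives versus Fréchet derivatives -/

variable {f : ℝ → ℝ → ℝ} {x y : ℝ}

/-- The line `s ↦ (s, y)` has derivative `(1, 0)`. [folklore] -/
theorem hasDerivAt_inl (x y : ℝ) : HasDerivAt (fun s : ℝ => (s, y)) ((1 : ℝ), (0 : ℝ)) x := by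
  simpa using (hasFDerivAt_prodMk_left (𝕜 := ℝ) x y).hasDerivAt

/-- The line `s ↦ (x, s)` has derivative `(0, 1)`. [folklore] -/
theorem hasDerivAt_inr (x y : ℝ) : HasDerivAt (fun s : ℝ => (x, s)) ((0 : ℝ), (1 : ℝ)) y := by
  simpa using (hasFDerivAt_prodMk_right (𝕜 := ℝ) x y).hasDerivAt

/-- The `x`-slice of a differentiable plane field has derivative `Df (x, y) (1, 0)`. [folklore] -/
theorem hasDerivAt_sliceX (hf : DifferentiableAt ℝ (fun q : ℝ × ℝ => f q.1 q.2) (x, y)) :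
    HasDerivAt (fun s => f s y) (fderiv ℝ (fun q : ℝ × ℝ => f q.1 q.2) (x, y) (1, 0)) x :=
  (hf.hasFDerivAt.comp_hasDerivAt x (hasDerivAt_inl x y) :)

/-- The `y`-slice of a differentiable plane field has derivative `Df (x, y) (0, 1)`. [folklore] -/
theorem hasDerivAt_sliceY (hf : DifferentiableAt ℝ (fun q : ℝ × ℝ => f q.1 q.2) (x, y)) :
    HasDerivAt (fun s => f x s) (fderiv ℝ (fun q : ℝ × ℝ => f q.1 q.2) (x, y) (0, 1)) y :=
  (hf.hasFDerivAt.comp_hasDerivAt y (hasDerivAt_inr x y) :)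

/-- `∂ₓ f = Df (1, 0)` at points of differentiability. [folklore] -/
theorem dX_eq_fderiv (hf : DifferentiableAt ℝ (fun q : ℝ × ℝ => f q.1 q.2) (x, y)) :
    dX f x y = fderiv ℝ (fun q : ℝ × ℝ => f q.1 q.2) (x, y) (1, 0) :=
  (hasDerivAt_sliceX hf).deriv

/-- `∂_y f = Df (0, 1)` at points of differentiability. [folklore] -/
theorem dY_eq_fderiv (hf : DifferentiableAt ℝ (fun q : ℝ × ℝ => f q.1 q.2) (x, y)) :
    dY f x y = fderiv ℝ (fun q : ℝ × ℝ => f q.1 q.2) (x, y) (0, 1) :=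
  (hasDerivAt_sliceY hf).deriv

/-- The `x`-slice has derivative `∂ₓ f`. [folklore] -/
theorem hasDerivAt_dX (hf : DifferentiableAt ℝ (fun q : ℝ × ℝ => f q.1 q.2) (x, y)) :
    HasDerivAt (fun s => f s y) (dX f x y) x := by
  rw [dX_eq_fderiv hf]; exact hasDerivAt_sliceX hf

/-- The `y`-slice has derivative `∂_y f`. [folklore] -/
theorem hasDerivAt_dY (hf : DifferentiableAt ℝ (fun q : ℝ × ℝ => f q.1 q.2) (x, y)) :
    HasDerivAt (fun s => f x s) (dY f x y) y := by
  rw [dY_eq_fderiv hf]; exact hasDerivAt_sliceY hf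

/-- `∂ₓ` of a jointly `Cⁿ⁺¹` field is jointly `Cⁿ`. [folklore] -/
theorem contDiff_dX {n : WithTop ℕ∞} (hf : ContDiff ℝ (n + 1) (fun q : ℝ × ℝ => f q.1 q.2)) :
    ContDiff ℝ n (fun q : ℝ × ℝ => dX f q.1 q.2) := by
  have h : ContDiff ℝ n (fun q : ℝ × ℝ => fderiv ℝ (fun q : ℝ × ℝ => f q.1 q.2) q (1, 0)) :=
    (hf.fderiv_right le_rfl).clm_apply contDiff_const
  have hd : Differentiable ℝ (fun q : ℝ × ℝ => f q.1 q.2) := hf.differentiable (by simp)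
  have heq : (fun q : ℝ × ℝ => dX f q.1 q.2) =
      fun q : ℝ × ℝ => fderiv ℝ (fun q : ℝ × ℝ => f q.1 q.2) q (1, 0) := by
    funext q; exact dX_eq_fderiv (hd (q.1, q.2))
  rw [heq]; exact h

/-- `∂_y` of a jointly `Cⁿ⁺¹` field is jointly `Cⁿ`. [folklore] -/
theorem contDiff_dY {n : WithTop ℕ∞} (hf : ContDiff ℝ (n + 1) (fun q : ℝ × ℝ => f q.1 q.2)) :
    ContDiff ℝ n (fun q : ℝ × ℝ => dY f q.1 q.2) := by
  have h : ContDiff ℝ n (fun q : ℝ × ℝ => fderiv ℝ (fun q : ℝ × ℝ => f q.1 q.2) q (0, 1)) :=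
    (hf.fderiv_right le_rfl).clm_apply contDiff_const
  have hd : Differentiable ℝ (fun q : ℝ × ℝ => f q.1 q.2) := hf.differentiable (by simp)
  have heq : (fun q : ℝ × ℝ => dY f q.1 q.2) =
      fun q : ℝ × ℝ => fderiv ℝ (fun q : ℝ × ℝ => f q.1 q.2) q (0, 1) := by
    funext q; exact dY_eq_fderiv (hd (q.1, q.2))
  rw [heq]; exact h

/-- `∂ₓ` of a jointly `Cⁿ` field is jointly `Cᵐ` for `m + 1 ≤ n`. [folklore] -/
theorem contDiff_dX_of_le {m n : WithTop ℕ∞} (hf : ContDiff ℝ n (fun q : ℝ × ℝ => f q.1 q.2))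
    (h : m + 1 ≤ n) : ContDiff ℝ m (fun q : ℝ × ℝ => dX f q.1 q.2) :=
  contDiff_dX (hf.of_le h)

/-- `∂_y` of a jointly `Cⁿ` field is jointly `Cᵐ` for `m + 1 ≤ n`. [folklore] -/
theorem contDiff_dY_of_le {m n : WithTop ℕ∞} (hf : ContDiff ℝ n (fun q : ℝ × ℝ => f q.1 q.2))
    (h : m + 1 ≤ n) : ContDiff ℝ m (fun q : ℝ × ℝ => dY f q.1 q.2) :=
  contDiff_dY (hf.of_le h)

/-- `∂ₓ (f - g) = ∂ₓ f - ∂ₓ g` at points where both fields are differentiable. [folklore] -/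
theorem dX_fun_sub {g : ℝ → ℝ → ℝ} (hf : DifferentiableAt ℝ (fun q : ℝ × ℝ => f q.1 q.2) (x, y))
    (hg : DifferentiableAt ℝ (fun q : ℝ × ℝ => g q.1 q.2) (x, y)) :
    dX (fun a b => f a b - g a b) x y = dX f x y - dX g x y :=
  ((hasDerivAt_dX hf).fun_sub (hasDerivAt_dX hg)).deriv

/-- `∂_y (f - g) = ∂_y f - ∂_y g` at points where both fields are differentiable. [folklore] -/
theorem dY_fun_sub {g : ℝ → ℝ → ℝ} (hf : DifferentiableAt ℝ (fun q : ℝ × ℝ => f q.1 q.2) (x, y))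
    (hg : DifferentiableAt ℝ (fun q : ℝ × ℝ => g q.1 q.2) (x, y)) :
    dY (fun a b => f a b - g a b) x y = dY f x y - dY g x y :=
  ((hasDerivAt_dY hf).fun_sub (hasDerivAt_dY hg)).deriv

/-- **Mixed partials commute** for jointly `C²` plane fields: `∂ₓ∂_y f = ∂_y∂ₓ f` (symmetry of the
second Fréchet derivative, Mathlib `ContDiffAt.isSymmSndFDerivAt`). [folklore] -/
theorem dX_dY_comm (hf : ContDiff ℝ 2 (fun q : ℝ × ℝ => f q.1 q.2)) (x y : ℝ) :
    dX (dY f) x y = dY (dX f) x y := by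
  set F : ℝ × ℝ → ℝ := fun q => f q.1 q.2 with hF
  set D : ℝ × ℝ → (ℝ × ℝ →L[ℝ] ℝ) := fderiv ℝ F with hD
  have hd : Differentiable ℝ F := hf.differentiable (by simp)
  have hDc : ContDiff ℝ 1 D := hf.fderiv_right (by norm_num)
  have hDd : Differentiable ℝ D := hDc.differentiable (by simp)
  -- `∂_y f = D (0,1)` and `∂ₓ f = D (1,0)` everywhere
  have hY : ∀ a b, dY f a b = D (a, b) (0, 1) := fun a b => dY_eq_fderiv (hd (a, b))
  have hX : ∀ a b, dX f a b = D (a, b) (1, 0) := fun a b => dX_eq_fderiv (hd (a, b))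
  -- derivative of `s ↦ D (s, y) e` and of `s ↦ D (x, s) e`
  have h1 : HasDerivAt (fun s => D (s, y) ((0 : ℝ), (1 : ℝ)))
      (fderiv ℝ D (x, y) ((1 : ℝ), (0 : ℝ)) ((0 : ℝ), (1 : ℝ))) x := by
    have hc : HasDerivAt (fun s => D (s, y)) (fderiv ℝ D (x, y) ((1 : ℝ), (0 : ℝ))) x :=
      (hDd (x, y)).hasFDerivAt.comp_hasDerivAt x (hasDerivAt_inl x y)
    exact ((ContinuousLinearMap.apply ℝ ℝ (((0 : ℝ), (1 : ℝ)) : ℝ × ℝ)).hasFDerivAt.comp_hasDerivAt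
      x hc :)
  have h2 : HasDerivAt (fun s => D (x, s) ((1 : ℝ), (0 : ℝ)))
      (fderiv ℝ D (x, y) ((0 : ℝ), (1 : ℝ)) ((1 : ℝ), (0 : ℝ))) y := by
    have hc : HasDerivAt (fun s => D (x, s)) (fderiv ℝ D (x, y) ((0 : ℝ), (1 : ℝ))) y :=
      (hDd (x, y)).hasFDerivAt.comp_hasDerivAt y (hasDerivAt_inr x y)
    exact ((ContinuousLinearMap.apply ℝ ℝ (((1 : ℝ), (0 : ℝ)) : ℝ × ℝ)).hasFDerivAt.comp_hasDerivAt
      y hc :)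
  have e1 : dX (dY f) x y = fderiv ℝ D (x, y) ((1 : ℝ), (0 : ℝ)) ((0 : ℝ), (1 : ℝ)) := by
    have hfun : (fun s => dY f s y) = fun s => D (s, y) ((0 : ℝ), (1 : ℝ)) := funext fun s => hY s y
    rw [dX, hfun]; exact h1.deriv
  have e2 : dY (dX f) x y = fderiv ℝ D (x, y) ((0 : ℝ), (1 : ℝ)) ((1 : ℝ), (0 : ℝ)) := by
    have hfun : (fun s => dX f x s) = fun s => D (x, s) ((1 : ℝ), (0 : ℝ)) := funext fun s => hX x s
    rw [dY, hfun]; exact h2.deriv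
  have hsymm : IsSymmSndFDerivAt ℝ F (x, y) :=
    (hf.contDiffAt (x := (x, y))).isSymmSndFDerivAt (by simp)
  rw [e1, e2]
  exact hsymm _ _

/-! ### Periodicity of slice derivatives -/

/-- `∂ₓ` of an `x`-periodic field is `x`-periodic. [folklore] -/
theorem dX_periodic {L : ℝ} {f : ℝ → ℝ → ℝ} (hf : ∀ x y, f (x + L) y = f x y) (x y : ℝ) :
    dX f (x + L) y = dX f x y := by
  have hfun : (fun s => f (s + L) y) = fun s => f s y := funext fun s => hf s y
  rw [dX, dX, ← deriv_comp_add_const, hfun]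

/-- `∂_y` of an `x`-periodic field is `x`-periodic. [folklore] -/
theorem dY_periodic {L : ℝ} {f : ℝ → ℝ → ℝ} (hf : ∀ x y, f (x + L) y = f x y) (x y : ℝ) :
    dY f (x + L) y = dY f x y := by
  have hfun : (fun s => f (x + L) s) = fun s => f x s := funext fun s => hf x s
  rw [dY, dY, hfun]


/-! ### Plane potentials of curl-free `C¹` fields -/

/-- A Fréchet derivative of a curried plane field splits along the axes:
`Df z v = v₁ ∂ₓf + v₂ ∂_yf`. [folklore] -/
theorem fderiv_apply_eq (hf : Differentiable ℝ (fun q : ℝ × ℝ => f q.1 q.2)) (x y : ℝ)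
    (v : ℝ × ℝ) : fderiv ℝ (fun q : ℝ × ℝ => f q.1 q.2) (x, y) v = v.1 * dX f x y + v.2 * dY f x y := by
  have hv : v = v.1 • ((1 : ℝ), (0 : ℝ)) + v.2 • ((0 : ℝ), (1 : ℝ)) := by ext <;> simp
  rw [dX_eq_fderiv (hf (x, y)), dY_eq_fderiv (hf (x, y))]
  conv_lhs => rw [hv]
  rw [map_add, map_smul, map_smul, smul_eq_mul, smul_eq_mul]

/-- **Plane Poincaré lemma, slice form.** A pair of jointly `C¹` plane fields `(F₁, F₂)` with
`∂_y F₁ = ∂ₓ F₂` everywhere is the gradient of a jointly `C¹` potential: `∂ₓ P = F₁`, `∂_y P = F₂`.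
The potential is the radial homotopy integral `P(z) = ∫₀¹ ⟨F(tz), z⟩ dt`
(`Literature.Analysis.Calculus.hasFDerivAt_radialIntegral`, applied on the balls `B(0, ‖z‖ + 1)`).
[folklore] -/
theorem exists_potential {F₁ F₂ : ℝ → ℝ → ℝ}
    (h₁ : ContDiff ℝ 1 (fun q : ℝ × ℝ => F₁ q.1 q.2)) (h₂ : ContDiff ℝ 1 (fun q : ℝ × ℝ => F₂ q.1 q.2))
    (hcurl : ∀ x y, dY F₁ x y = dX F₂ x y) :
    ∃ P : ℝ → ℝ → ℝ, ContDiff ℝ 1 (fun q : ℝ × ℝ => P q.1 q.2) ∧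
      (∀ x y, dX P x y = F₁ x y) ∧ (∀ x y, dY P x y = F₂ x y) := by
  -- the covector field `A = F₁ dx + F₂ dy`
  set A : ℝ × ℝ → (ℝ × ℝ →L[ℝ] ℝ) := fun q =>
    F₁ q.1 q.2 • ContinuousLinearMap.fst ℝ ℝ ℝ + F₂ q.1 q.2 • ContinuousLinearMap.snd ℝ ℝ ℝ with hA
  have hAc : ContDiff ℝ 1 A := (h₁.smul contDiff_const).add (h₂.smul contDiff_const)
  have hA_apply : ∀ q w, A q w = F₁ q.1 q.2 * w.1 + F₂ q.1 q.2 * w.2 := by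
    intro q w; simp [hA]
  have hd₁ : Differentiable ℝ (fun q : ℝ × ℝ => F₁ q.1 q.2) := h₁.differentiable (by simp)
  have hd₂ : Differentiable ℝ (fun q : ℝ × ℝ => F₂ q.1 q.2) := h₂.differentiable (by simp)
  have hAd : ∀ q, HasFDerivAt A
      ((fderiv ℝ (fun q : ℝ × ℝ => F₁ q.1 q.2) q).smulRight (ContinuousLinearMap.fst ℝ ℝ ℝ) +
        (fderiv ℝ (fun q : ℝ × ℝ => F₂ q.1 q.2) q).smulRight (ContinuousLinearMap.snd ℝ ℝ ℝ)) q :=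
    fun q => ((hd₁ q).hasFDerivAt.smul_const (ContinuousLinearMap.fst ℝ ℝ ℝ)).add
      ((hd₂ q).hasFDerivAt.smul_const (ContinuousLinearMap.snd ℝ ℝ ℝ))
  -- closedness: the derivative of `A` is symmetric
  have hsymm : ∀ z : ℝ × ℝ, ∀ v w : ℝ × ℝ, fderiv ℝ A z v w = fderiv ℝ A z w v := by
    rintro ⟨zx, zy⟩ v w
    rw [(hAd (zx, zy)).fderiv]
    simp only [FunLike.coe_add, Pi.add_apply, ContinuousLinearMap.smulRight_apply,
      FunLike.coe_smul, Pi.smul_apply, ContinuousLinearMap.coe_fst',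
      ContinuousLinearMap.coe_snd', smul_eq_mul, fderiv_apply_eq hd₁, fderiv_apply_eq hd₂]
    linear_combination (v.2 * w.1 - v.1 * w.2) * hcurl zx zy
  -- the radial homotopy potential
  set P' : ℝ × ℝ → ℝ :=
    fun z => ∫ t in (0 : ℝ)..1, A ((0 : ℝ × ℝ) + t • (z - 0)) (z - 0) with hP'
  have hP'd : ∀ z, HasFDerivAt P' (A z) z := by
    intro z
    have hz : z ∈ Metric.ball (0 : ℝ × ℝ) (‖z‖ + 1) := by
      rw [Metric.mem_ball, dist_zero_right]; linarith
    exact Literature.Analysis.Calculus.hasFDerivAt_radialIntegral hAc.contDiffOn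
      (fun z _ v w => hsymm z v w) hz
  refine ⟨fun x y => P' (x, y), ?_, ?_, ?_⟩
  · have hP'c : ContDiff ℝ 1 P' := by
      rw [contDiff_one_iff_fderiv]
      refine ⟨fun z => (hP'd z).differentiableAt, ?_⟩
      have hfd : fderiv ℝ P' = A := funext fun z => (hP'd z).fderiv
      rw [hfd]; exact hAc.continuous
    exact hP'c
  · intro x y
    have h : HasDerivAt (fun s => P' (s, y)) (A (x, y) ((1 : ℝ), (0 : ℝ))) x :=
      ((hP'd (x, y)).comp_hasDerivAt x (hasDerivAt_inl x y) :)
    rw [hA_apply] at h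
    simp only [mul_one, mul_zero, add_zero] at h
    exact h.deriv
  · intro x y
    have h : HasDerivAt (fun s => P' (x, s)) (A (x, y) ((0 : ℝ), (1 : ℝ))) y :=
      ((hP'd (x, y)).comp_hasDerivAt y (hasDerivAt_inr x y) :)
    rw [hA_apply] at h
    simp only [mul_one, mul_zero, zero_add] at h
    exact h.deriv

/-- **Period shift of a potential.** If `P` is a jointly `C¹` potential of `(F₁, F₂)` and
`F₁, F₂` are `L`-periodic in `x`, then `P (x + L, y) - P (x, y)` is the constant
`∫₀ᴸ F₁ (s, y₀) ds` (any `y₀`): its `x`- and `y`-derivatives vanish by periodicity, and at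
`x = 0` it is a period integral of `∂ₓ P` (fundamental theorem of calculus). [folklore] -/
theorem potential_shift_eq_integral {P F₁ F₂ : ℝ → ℝ → ℝ} {L : ℝ}
    (hP : ContDiff ℝ 1 (fun q : ℝ × ℝ => P q.1 q.2))
    (hX : ∀ x y, dX P x y = F₁ x y) (hY : ∀ x y, dY P x y = F₂ x y)
    (hF₁ : Continuous (fun q : ℝ × ℝ => F₁ q.1 q.2))
    (h₁ : ∀ x y, F₁ (x + L) y = F₁ x y) (h₂ : ∀ x y, F₂ (x + L) y = F₂ x y) (x y y₀ : ℝ) :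
    P (x + L) y - P x y = ∫ s in (0 : ℝ)..L, F₁ s y₀ := by
  have hd : Differentiable ℝ (fun q : ℝ × ℝ => P q.1 q.2) := hP.differentiable (by simp)
  have hPX : ∀ a b, HasDerivAt (fun s => P s b) (F₁ a b) a := fun a b => by
    have h := hasDerivAt_dX (hd (a, b)); rwa [hX] at h
  have hPY : ∀ a b, HasDerivAt (fun s => P a s) (F₂ a b) b := fun a b => by
    have h := hasDerivAt_dY (hd (a, b)); rwa [hY] at h
  -- constant in `x`
  have hgx : ∀ b a, P (a + L) b - P a b = P (0 + L) b - P 0 b := by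
    intro b a
    have hdiff : ∀ s, HasDerivAt (fun s => P (s + L) b - P s b) 0 s := by
      intro s
      have h1 : HasDerivAt (fun s => P (s + L) b) (F₁ (s + L) b) s :=
        HasDerivAt.comp_add_const s L (hPX (s + L) b)
      have h2 := h1.sub (hPX s b)
      rw [h₁, sub_self] at h2
      exact h2
    exact is_const_of_deriv_eq_zero (fun s => (hdiff s).differentiableAt)
      (fun s => (hdiff s).deriv) a 0
  -- constant in `y`
  have hgy : ∀ a b, P (a + L) b - P a b = P (a + L) y₀ - P a y₀ := by
    intro a b
    have hdiff : ∀ s, HasDerivAt (fun s => P (a + L) s - P a s) 0 s := by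
      intro s
      have h2 := (hPY (a + L) s).sub (hPY a s)
      rw [h₂, sub_self] at h2
      exact h2
    exact is_const_of_deriv_eq_zero (fun s => (hdiff s).differentiableAt)
      (fun s => (hdiff s).deriv) b y₀
  rw [hgy x y, hgx y₀ x, zero_add]
  have hcont : Continuous fun s => F₁ s y₀ := hF₁.comp (continuous_id.prodMk continuous_const)
  rw [integral_eq_sub_of_hasDerivAt (fun s _ => hPX s y₀) (hcont.intervalIntegrable _ _)]

/-! ### Period integrals of exact terms and linear growth of fields with bounded `∂_y` -/

/-- Slices `s ↦ f s y` of a jointly continuous field are continuous. [folklore] -/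
theorem continuous_sliceX {f : ℝ → ℝ → ℝ} (hf : Continuous (fun q : ℝ × ℝ => f q.1 q.2)) (y : ℝ) :
    Continuous fun s => f s y :=
  hf.comp (continuous_id.prodMk continuous_const)

/-- Slices `s ↦ f x s` of a jointly continuous field are continuous. [folklore] -/
theorem continuous_sliceY {f : ℝ → ℝ → ℝ} (hf : Continuous (fun q : ℝ × ℝ => f q.1 q.2)) (x : ℝ) :
    Continuous fun s => f x s :=
  hf.comp (continuous_const.prodMk continuous_id)

/-- **The exact terms have zero period integral**: for an `x`-periodic jointly `C²` field `u`,
`∫₀ᴸ (-(u ∂ₓu) + ν ∂ₓ∂ₓu)(s, y) ds = [-(u²/2) + ν ∂ₓu]₀ᴸ = 0`. [folklore] -/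
theorem integral_exact_terms_eq_zero {ν L : ℝ} {u : ℝ → ℝ → ℝ}
    (hu : ContDiff ℝ 2 (fun q : ℝ × ℝ => u q.1 q.2)) (hper : ∀ x y, u (x + L) y = u x y) (y : ℝ) :
    ∫ s in (0 : ℝ)..L, (-(u s y * dX u s y) + ν * dX (dX u) s y) = 0 := by
  have hXu : ContDiff ℝ 1 (fun q : ℝ × ℝ => dX u q.1 q.2) := contDiff_dX_of_le hu (by norm_num)
  have hdu : Differentiable ℝ (fun q : ℝ × ℝ => u q.1 q.2) := hu.differentiable (by simp)
  have hdXu : Differentiable ℝ (fun q : ℝ × ℝ => dX u q.1 q.2) := hXu.differentiable (by simp)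
  have G : ∀ s, HasDerivAt (fun s => -(u s y * u s y / 2) + ν * dX u s y)
      (-((dX u s y * u s y + u s y * dX u s y) / 2) + ν * dX (dX u) s y) s := fun s =>
    (((hasDerivAt_dX (hdu (s, y))).fun_mul (hasDerivAt_dX (hdu (s, y)))).div_const 2).fun_neg.fun_add
      ((hasDerivAt_dX (hdXu (s, y))).const_mul ν)
  have hcont : Continuous fun s => -((dX u s y * u s y + u s y * dX u s y) / 2) + ν * dX (dX u) s y := by
    have c1 := continuous_sliceX hu.continuous y
    have c2 := continuous_sliceX hXu.continuous y
    have c3 := continuous_sliceX (contDiff_dX_of_le (m := 0) hXu (by norm_num)).continuous y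
    fun_prop
  have hcongr : (fun s => -(u s y * dX u s y) + ν * dX (dX u) s y) =
      fun s => -((dX u s y * u s y + u s y * dX u s y) / 2) + ν * dX (dX u) s y := by
    funext s; ring
  rw [hcongr, integral_eq_sub_of_hasDerivAt (fun s _ => G s) (hcont.intervalIntegrable _ _)]
  have h1 : u L y = u 0 y := by simpa using hper 0 y
  have h2 : dX u L y = dX u 0 y := by simpa using dX_periodic hper 0 y
  rw [h1, h2]; ring

/-- **Linear growth across the layer.** If `|∂_y f| ≤ C` everywhere, then
`|f (x, y) - f (x, 0)| ≤ C |y|` (mean value inequality on the slice). [folklore] -/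
theorem abs_sub_le_of_dY_bound {f : ℝ → ℝ → ℝ} {C : ℝ}
    (hf : Differentiable ℝ (fun q : ℝ × ℝ => f q.1 q.2)) (hC : ∀ x y, |dY f x y| ≤ C) (x y : ℝ) :
    |f x y - f x 0| ≤ C * |y| := by
  have h := Convex.norm_image_sub_le_of_norm_deriv_le (f := fun s => f x s) (s := Set.univ)
    (fun t _ => (hasDerivAt_dY (hf (x, t))).differentiableAt)
    (fun t _ => by rw [(hasDerivAt_dY (hf (x, t))).deriv]; exact hC x t)
    convex_univ (Set.mem_univ 0) (Set.mem_univ y)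
  simpa using h

/-- From `e^{-a|y|} ≤ 1`: a decay bound `g ≤ C e^{-a|y|}` with `0 ≤ g` gives `g ≤ C` and `0 ≤ C`.
[folklore] -/
theorem le_of_le_mul_exp {g C a y : ℝ} (ha : 0 < a) (hg : 0 ≤ g)
    (h : g ≤ C * Real.exp (-a * |y|)) : g ≤ C ∧ 0 ≤ C := by
  have he : Real.exp (-a * |y|) ≤ 1 := by
    rw [Real.exp_le_one_iff]; nlinarith [abs_nonneg y]
  have he0 : 0 < Real.exp (-a * |y|) := Real.exp_pos _
  have hC : 0 ≤ C := by
    by_contra hC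
    have : C * Real.exp (-a * |y|) < 0 := mul_neg_of_neg_of_pos (lt_of_not_ge hC) he0
    linarith
  exact ⟨h.trans (by nlinarith), hC⟩

/-- `y e^{-a y} → 0` and `e^{-a y} → 0` as `y → +∞`, packaged as the decay of
`(A + B y) e^{-a y}`. [folklore] -/
theorem tendsto_affine_mul_exp_neg {a : ℝ} (ha : 0 < a) (A B : ℝ) :
    Tendsto (fun y : ℝ => (A + B * y) * Real.exp (-a * y)) atTop (𝓝 0) := by
  have T0 : Tendsto (fun y : ℝ => Real.exp (-a * y)) atTop (𝓝 0) := by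
    simpa [Real.rpow_zero] using tendsto_rpow_mul_exp_neg_mul_atTop_nhds_zero 0 a ha
  have T1 : Tendsto (fun y : ℝ => y * Real.exp (-a * y)) atTop (𝓝 0) := by
    simpa [Real.rpow_one] using tendsto_rpow_mul_exp_neg_mul_atTop_nhds_zero 1 a ha
  have h := (T0.const_mul A).add (T1.const_mul B)
  simp only [mul_zero, add_zero] at h
  refine h.congr fun y => ?_
  ring


end PressureTools

open Literature.Analysis.FluidPDE Literature.Analysis.FluidPDE.StretchedLayer in
/-- **Plane Poincaré lemma in slice form** (registered helper stub
`stub_pressureReconstruction_planePotential` of stmt-AnomalousDissipation-3009, serving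
`stub_pressureReconstruction`): a jointly `C¹` pair `(F₁, F₂)` with `∂_y F₁ = ∂ₓ F₂` is the slice
gradient of a jointly `C¹` potential. This is `PressureTools.exists_potential`. [folklore] -/
theorem stub_pressureReconstruction_planePotential :
    ∀ (F₁ F₂ : ℝ → ℝ → ℝ), ContDiff ℝ 1 (fun q : ℝ × ℝ => F₁ q.1 q.2) →
      ContDiff ℝ 1 (fun q : ℝ × ℝ => F₂ q.1 q.2) → (∀ x y, dY F₁ x y = dX F₂ x y) →
      ∃ P : ℝ → ℝ → ℝ, ContDiff ℝ 1 (fun q : ℝ × ℝ => P q.1 q.2) ∧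
        (∀ x y, dX P x y = F₁ x y) ∧ (∀ x y, dY P x y = F₂ x y) :=
  fun _ _ h₁ h₂ hc => PressureTools.exists_potential h₁ h₂ hc

end Summit.AnomalousDissipation.AnomalousDissipation.Theorems.MarginalStabilityChainStretchedVortexRows

end
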